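import Summits.ResolutionOfSingularities.ResolutionOfSingularities.Theorems.FrobeniusLadderFInjectiveMacaulayficationE8ChartZUnit

/-!
# The `X₂`-chart of the second blow-up of `E₈⁰` (char `3` tower) misses the exceptional divisor

Support file for crux stmt-ResolutionOfSingularities-15315
(`FrobeniusLadder.FInjectiveMacaulayfication`, line `Sketch`): stub `stub_e7ChartX2Unit` of the
CALIBRATION package, second step of the characteristic-`3` tower over the rational double point
`E₈⁰` (the statement itself holds over any field).

Let `k` be a field, `g = X₂² + X₁ X₀³ + X₁³ ∈ k[X₀, X₁, X₂]`, `R' = k[X₀, X₁, X₂]/(g)` and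
`𝔪' = (x̄₀, x̄₁, x̄₂) ⊆ R'` (`x̄ⱼ` the class of `Xⱼ`). The blowing up
`Bl_𝔪'(Spec R') = Proj R'[𝔪't]` is covered by the three charts `D₊(x̄ⱼ t)`; the coordinate ring
of the `X₂`-chart is `(R'[𝔪't])_{(x̄₂t)} = HomogeneousLocalization.Away (reesGrading 𝔪') (reesT x̄₂ _)`,
Stacks' affine blowup algebra `R'[𝔪'/x̄₂]`, in which the exceptional divisor is cut out by the
image `u = x̄₂/1 = reesChartBase x̄₂ _ x̄₂` of `x̄₂`. We prove that `u` is a UNIT of this chart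
ring (`stub_e7ChartX2Unit`): the `X₂`-chart contains no point of the exceptional divisor.

Proof. In `R'` we have `x̄₂² = -(x̄₁ x̄₀³ + x̄₁³)`, hence `x̄₂ · w = 1` in `R'[1/x̄₂]` for
`w = -x̄₂ (x̄₁/x̄₂) (x̄₀/x̄₂)³ - (x̄₁/x̄₂)³` (`mul_eq_one_of_rel'`), and `w` lies in the affine
blowup algebra `R'[𝔪'/x̄₂] ⊆ R'[1/x̄₂]` generated over `R'` by the `c/x̄₂`, `c ∈ 𝔪'`
(`div_mem_blowupAlgebra`). The chart map `reesChart` is injective with image `R'[𝔪'/x̄₂]` and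
sends `u ↦ x̄₂/1`, so the pull-back of `w` is an inverse of `u`
(`E8ChartZUnit.isUnit_reesChartBase_of_mul_eq_one`).

References: folklore; The Stacks Project, Tag 0804 (blowing up is `Proj` of the Rees algebra,
`D₊(a⁽¹⁾) = Spec R[I/a]`) and Tag 07Z3 (`R[I/a] ⊆ R[1/a]`) for the chart rings.
-/

-- single-problem summit: the doubled namespace component is forced
set_option linter.dupNamespace false

noncomputable section

namespace Summit.ResolutionOfSingularities.ResolutionOfSingularities.Theorems.FInjectiveMacaulayfication.E7ChartX2Unit

open AlgebraicGeometry Literature.AlgebraicGeometry.Resolution MvPolynomial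

/-- The polynomial identity behind the `X₂`-chart of the second blow-up: in a commutative ring,
if `A t = 1` and `A² + C B³ + C³ = 0`, then `A · (-(A (C t) (B t)³) - (C t)³) = 1`
(indeed `A · w = -(C B³ + C³) t² = A² t² = 1`). [folklore] -/
theorem mul_eq_one_of_rel' {L : Type*} [CommRing L] {A B C t : L} (hinv : A * t = 1)
    (hrel : A ^ 2 + C * B ^ 3 + C ^ 3 = 0) :
    A * (-(A * (C * t) * (B * t) ^ 3) - (C * t) ^ 3) = 1 := by
  linear_combination (-t ^ 2) * hrel +
    (A * t + 1 - C * B ^ 3 * t ^ 2 * (1 + A * t) - C ^ 3 * t ^ 2) * hinv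

/-- CALIBRATION, `X₂`-chart of the second step (stub `stub_e7ChartX2Unit` of line `Sketch`):
for a field `k`, `g = X₂² + X₁ X₀³ + X₁³`, `R' = k[X₀, X₁, X₂]/(g)` and `𝔪' = (x̄₀, x̄₁, x̄₂)`,
the image `x̄₂/1` of `x̄₂` in the chart ring `(R'[𝔪't])_{(x̄₂t)} = R'[𝔪'/x̄₂]` of
`Bl_𝔪'(Spec R')` is a unit — the `X₂`-chart misses the exceptional divisor — because
`x̄₂ · (-x̄₂ (x̄₁/x̄₂) (x̄₀/x̄₂)³ - (x̄₁/x̄₂)³) = 1` in `R'[1/x̄₂]` with the second factor in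
`R'[𝔪'/x̄₂]`, the image of the injective chart map. [folklore] -/
theorem stub_e7ChartX2Unit : ∀ (k : Type) [Field k] (g : MvPolynomial (Fin 3) k),
    g = MvPolynomial.X 2 ^ 2 + MvPolynomial.X 1 * MvPolynomial.X 0 ^ 3 + MvPolynomial.X 1 ^ 3 →
    ∀ (x : Fin 3 → MvPolynomial (Fin 3) k ⧸ Ideal.span {g}),
      x = (fun j : Fin 3 => Ideal.Quotient.mk (Ideal.span {g}) (MvPolynomial.X j)) →
      IsUnit (reesChartBase (x 2) (Ideal.subset_span (Set.mem_range_self 2)) (x 2)) := by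
  intro k _ g hg x hx
  -- the relation `x̄₂² + x̄₁ x̄₀³ + x̄₁³ = 0` in `R' = k[X₀, X₁, X₂]/(g)`
  have hrelR : x 2 ^ 2 + x 1 * x 0 ^ 3 + x 1 ^ 3 = 0 := by
    have h0 : Ideal.Quotient.mk (Ideal.span {g})
        (MvPolynomial.X 2 ^ 2 + MvPolynomial.X 1 * MvPolynomial.X 0 ^ 3 + MvPolynomial.X 1 ^ 3) =
          0 :=
      Ideal.Quotient.eq_zero_iff_mem.mpr (by rw [← hg]; exact Ideal.mem_span_singleton_self g)
    subst hx
    simpa only [map_add, map_mul, map_pow] using h0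
  -- ... mapped to `R'[1/x̄₂]`, together with `x̄₂ · (1/x̄₂) = 1`
  have hrelL := congrArg (algebraMap _ (Localization.Away (x 2))) hrelR
  simp only [map_add, map_mul, map_pow, map_zero] at hrelL
  have hinv := IsLocalization.Away.mul_invSelf (S := Localization.Away (x 2)) (x 2)
  -- `w = -x̄₂ (x̄₁/x̄₂) (x̄₀/x̄₂)³ - (x̄₁/x̄₂)³ ∈ R'[𝔪'/x̄₂]` is an inverse of `x̄₂` in `R'[1/x̄₂]`
  have h0 : x 0 ∈ Ideal.span (Set.range x) := Ideal.subset_span (Set.mem_range_self 0)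
  have h1 : x 1 ∈ Ideal.span (Set.range x) := Ideal.subset_span (Set.mem_range_self 1)
  exact E8ChartZUnit.isUnit_reesChartBase_of_mul_eq_one (x 2) _
    (Subalgebra.sub_mem _
      (Subalgebra.neg_mem _
        (Subalgebra.mul_mem _
          (Subalgebra.mul_mem _ (Subalgebra.algebraMap_mem _ (x 2))
            (div_mem_blowupAlgebra _ (x 2) h1))
          (Subalgebra.pow_mem _ (div_mem_blowupAlgebra _ (x 2) h0) 3)))
      (Subalgebra.pow_mem _ (div_mem_blowupAlgebra _ (x 2) h1) 3))
    (mul_eq_one_of_rel' hinv hrelL)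

end Summit.ResolutionOfSingularities.ResolutionOfSingularities.Theorems.FInjectiveMacaulayfication.E7ChartX2Unit

end
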